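import Summits.KontsevichZagierPeriods.Zeta5Search.Barrier.ConeGammaCuspPeriodRays

/-!
# ζ(5) search — BARRIER: THE TWO FINITE FORMS OF A CUSP TOP — one Farkas certificate per ORDER TYPE (≤ 28!), one sign per RAY CLASS

HONEST FRAMING (cell `pub-zeta5`): systematic search; no irrationality claim unless kernel-certified. MODEL objects
under Brown–Zudilin's (28)+(30) accounting ([BZ22] = arXiv:2210.03391; (28) observed, not proved); nothing here is a
statement about `ζ(5)`, any `γ` of record, the cone's supremum (C2 OPEN) or the value / sign of the cusp slope at a
named direction (DATA of the cell); no order type, ray, certificate or count at a named direction enters the kernel;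
S-E stays CONJECTURED; records in print UNMOVED. Prover P2 g35, item «THE RAY CRITERION AND THE ORDER-TYPE FORM»,
file (3) (theorems only) — P2 g34's successor menu (a) «the order-type form», and its V-side twin.

THE POINT. Both exact criteria for a cusp top — P2 g34's «every generic reference carries a Farkas certificate»
(H-side) and file (2)'s «`σ ≤ 0` at every ray» (V-side) — quantify over infinitely many displacements but depend on
them only through FINITE combinatorial data:
* `exists_perm_of_generic` — a generic reference `δ₀` has a sorting permutation `π ∈ S₂₈` (`π k < π l ⇔ r_k(δ₀) <
  r_l(δ₀)`); **`farkas_certificate_iff_of_same_order`** — two generic references with the same ORDER TYPE have the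
  same prefix sets, the same chamber weights, the same closed chamber and the same Farkas certificates;
* **`exists_orderType_representatives`** — there is a finite set `S` of generic references, `#S ≤ 28!`, meeting every
  realised order type; **`forall_cuspSlope_nonpos_iff_finset_farkas`** — for any such `S`: «`σ ≤ 0` in every
  direction» ⇔ the finitely many references of `S` carry Farkas certificates (P2 g34's criterion as a literally finite
  conjunction; the realised order types are the chambers of the rate arrangement — far fewer than `28!`, uncounted here);
* **`cuspSlope_ray_of_same_ties`** — two rays with the same TIE TYPE differ by the gauge `x' = u•x + t•s(a)`, `u ≠ 0`,
  so `σ(x')` is `u·σ(x)` or `|u|·σ(−x)`; **`exists_ray_representatives`** — a finite set of rays meets every ray class up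
  to a POSITIVE gauge; **`forall_cuspSlope_nonpos_iff_finset_rays`** — for any such set: «`σ ≤ 0` in every direction» ⇔
  `σ ≤ 0` at its finitely many rays;
* canonical forms (P2 g33's `F = Σ_b patternN_b`; hpos / hT / hper / hF only).
NOT here: any count beyond `28!`, any representative at a named direction; `γ`, C2, S-E, `ζ(5)`.
-/

noncomputable section

open Set MeasureTheory Finset
open scoped Topology

namespace Summit.KontsevichZagierPeriods.Zeta5Search.Barrier.ConeGamma

/-! ### Order types of generic references -/

/-- **A generic reference has a sorting permutation**: `π ∈ S₂₈` with `π k < π l ⇔ r_k(δ₀) < r_l(δ₀)` (`π k` = the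
number of forms slower than `k`). -/
theorem exists_perm_of_generic {a : Dir} {δ₀ : Fin 8 → ℝ}
    (hgen : ∀ k l : Fin 28, k ≠ l → phiForm δ₀ k / h28 a k ≠ phiForm δ₀ l / h28 a l) :
    ∃ π : Equiv.Perm (Fin 28), ∀ k l, π k < π l ↔ phiForm δ₀ k / h28 a k < phiForm δ₀ l / h28 a l := by
  classical
  -- the rank of a form: how many forms are strictly slower
  have hlt : ∀ k, (Finset.univ.filter fun j => phiForm δ₀ j / h28 a j < phiForm δ₀ k / h28 a k).card < 28 := by
    intro k
    have h : (Finset.univ.filter fun j => phiForm δ₀ j / h28 a j < phiForm δ₀ k / h28 a k) ⊂ Finset.univ :=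
      Finset.filter_ssubset.mpr ⟨k, Finset.mem_univ _, lt_irrefl _⟩
    simpa using Finset.card_lt_card h
  have hmono : ∀ k l, phiForm δ₀ k / h28 a k < phiForm δ₀ l / h28 a l →
      (Finset.univ.filter fun j => phiForm δ₀ j / h28 a j < phiForm δ₀ k / h28 a k).card <
        (Finset.univ.filter fun j => phiForm δ₀ j / h28 a j < phiForm δ₀ l / h28 a l).card := by
    intro k l hkl
    refine Finset.card_lt_card ⟨fun j hj => ?_, fun hsub => ?_⟩
    · simp only [Finset.mem_filter, Finset.mem_univ, true_and] at hj ⊢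
      exact hj.trans hkl
    · have hk := hsub (by simpa using hkl)
      simp at hk
  obtain ⟨g, hg⟩ : ∃ g : Fin 28 → Fin 28, ∀ k, g k =
      ⟨(Finset.univ.filter fun j => phiForm δ₀ j / h28 a j < phiForm δ₀ k / h28 a k).card, hlt k⟩ := ⟨_, fun _ => rfl⟩
  have hg' : ∀ k l, phiForm δ₀ k / h28 a k < phiForm δ₀ l / h28 a l → g k < g l := fun k l hkl => by
    rw [hg, hg, Fin.mk_lt_mk]; exact hmono k l hkl
  have hinj : Function.Injective g := by
    intro k l hkl
    by_contra hne
    rcases lt_or_gt_of_ne (hgen k l hne) with h | h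
    · exact absurd hkl (hg' k l h).ne
    · exact absurd hkl (hg' l k h).ne'
  refine ⟨Equiv.ofBijective g (Finite.injective_iff_bijective.mp hinj), fun k l => ⟨fun h => ?_, hg' k l⟩⟩
  simp only [Equiv.ofBijective_apply] at h
  have hne : k ≠ l := fun e => by rw [e] at h; exact lt_irrefl _ h
  rcases lt_or_gt_of_ne (hgen k l hne) with h' | h'
  · exact h'
  · exact absurd h (lt_asymm (hg' l k h'))

/-- **SAME ORDER TYPE, SAME CERTIFICATES** (any `F`): if two references induce the same strict order on the 28 rates,
their prefix sets `P≤(k)`, `P<(k)`, hence their chamber weights, their pair selections and their Farkas certificates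
coincide — the certificate predicate of P2 g34 depends on `δ₀` only through its ORDER TYPE. -/
theorem farkas_certificate_iff_of_same_order {a : Dir} (F : Finset (Fin 28) → ℝ) {δ₀ δ₁ : Fin 8 → ℝ}
    (hsame : ∀ k l, phiForm δ₀ k / h28 a k < phiForm δ₀ l / h28 a l ↔ phiForm δ₁ k / h28 a k < phiForm δ₁ l / h28 a l) :
    (∃ μ : Fin 28 → Fin 28 → ℝ, (∀ k l, 0 ≤ μ k l) ∧ ∀ δ : Fin 8 → ℝ,
        ∑ k, (F (Finset.univ.filter fun l => phiForm δ₀ k / h28 a k ≤ phiForm δ₀ l / h28 a l) -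
            F (Finset.univ.filter fun l => phiForm δ₀ k / h28 a k < phiForm δ₀ l / h28 a l)) *
          (phiForm δ k / h28 a k) +
        ∑ k, ∑ l, (if phiForm δ₀ k / h28 a k < phiForm δ₀ l / h28 a l then
          μ k l * (phiForm δ l / h28 a l - phiForm δ k / h28 a k) else 0) = 0) ↔
      ∃ μ : Fin 28 → Fin 28 → ℝ, (∀ k l, 0 ≤ μ k l) ∧ ∀ δ : Fin 8 → ℝ,
        ∑ k, (F (Finset.univ.filter fun l => phiForm δ₁ k / h28 a k ≤ phiForm δ₁ l / h28 a l) -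
            F (Finset.univ.filter fun l => phiForm δ₁ k / h28 a k < phiForm δ₁ l / h28 a l)) *
          (phiForm δ k / h28 a k) +
        ∑ k, ∑ l, (if phiForm δ₁ k / h28 a k < phiForm δ₁ l / h28 a l then
          μ k l * (phiForm δ l / h28 a l - phiForm δ k / h28 a k) else 0) = 0 := by
  classical
  have hle : ∀ k l, phiForm δ₀ k / h28 a k ≤ phiForm δ₀ l / h28 a l ↔
      phiForm δ₁ k / h28 a k ≤ phiForm δ₁ l / h28 a l := fun k l => by
    rw [← not_lt, ← not_lt, hsame l k]
  have e1 : ∀ k, (Finset.univ.filter fun l => phiForm δ₀ k / h28 a k ≤ phiForm δ₀ l / h28 a l) =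
      Finset.univ.filter fun l => phiForm δ₁ k / h28 a k ≤ phiForm δ₁ l / h28 a l := fun k =>
    Finset.filter_congr fun l _ => hle k l
  have e2 : ∀ k, (Finset.univ.filter fun l => phiForm δ₀ k / h28 a k < phiForm δ₀ l / h28 a l) =
      Finset.univ.filter fun l => phiForm δ₁ k / h28 a k < phiForm δ₁ l / h28 a l := fun k =>
    Finset.filter_congr fun l _ => hsame k l
  have e3 : ∀ (μ : Fin 28 → Fin 28 → ℝ) (δ : Fin 8 → ℝ) k l,
      (if phiForm δ₀ k / h28 a k < phiForm δ₀ l / h28 a l then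
        μ k l * (phiForm δ l / h28 a l - phiForm δ k / h28 a k) else 0) =
      (if phiForm δ₁ k / h28 a k < phiForm δ₁ l / h28 a l then
        μ k l * (phiForm δ l / h28 a l - phiForm δ k / h28 a k) else 0) := fun μ δ k l =>
    if_congr (hsame k l) rfl rfl
  simp_rw [e1, e2, e3]

/-- **SAME ORDER TYPE, SAME CLOSED CHAMBER.** -/
theorem refines_iff_of_same_order {a : Dir} {δ₀ δ₁ : Fin 8 → ℝ}
    (hsame : ∀ k l, phiForm δ₀ k / h28 a k < phiForm δ₀ l / h28 a l ↔ phiForm δ₁ k / h28 a k < phiForm δ₁ l / h28 a l)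
    (δ : Fin 8 → ℝ) :
    (∀ k l : Fin 28, phiForm δ k / h28 a k < phiForm δ l / h28 a l → phiForm δ₀ k / h28 a k < phiForm δ₀ l / h28 a l) ↔
      ∀ k l : Fin 28, phiForm δ k / h28 a k < phiForm δ l / h28 a l →
        phiForm δ₁ k / h28 a k < phiForm δ₁ l / h28 a l :=
  forall_congr' fun k => forall_congr' fun l => imp_congr_right fun _ => hsame k l

/-- **FINITELY MANY ORDER TYPES — AT MOST `28!` REFERENCES SUFFICE.** All 28 forms of `a` positive. There is a finite set
`S` of generic references with `#S ≤ 28!` such that every generic reference has the order type of some member of `S`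
(one representative per realised order type; order types inject into `S₂₈` by `exists_perm_of_generic`). The realised
order types are the chambers of the rate arrangement `{r_k = r_l}` in `ℝ⁸` — far fewer than `28!`; no count is claimed. -/
theorem exists_orderType_representatives (a : Dir) :
    ∃ S : Finset (Fin 8 → ℝ), S.card ≤ Nat.factorial 28 ∧
      (∀ δ₁ ∈ S, ∀ k l : Fin 28, k ≠ l → phiForm δ₁ k / h28 a k ≠ phiForm δ₁ l / h28 a l) ∧
      ∀ δ₀ : Fin 8 → ℝ, (∀ k l : Fin 28, k ≠ l → phiForm δ₀ k / h28 a k ≠ phiForm δ₀ l / h28 a l) →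
        ∃ δ₁ ∈ S, ∀ k l, phiForm δ₀ k / h28 a k < phiForm δ₀ l / h28 a l ↔
          phiForm δ₁ k / h28 a k < phiForm δ₁ l / h28 a l := by
  classical
  -- order type of a reference, the realised ones, one representative each
  obtain ⟨ot, hot⟩ : ∃ ot : (Fin 8 → ℝ) → Fin 28 → Fin 28 → Bool, ∀ δ k l,
      ot δ k l = decide (phiForm δ k / h28 a k < phiForm δ l / h28 a l) := ⟨_, fun _ _ _ => rfl⟩
  have hot' : ∀ δ δ', ot δ = ot δ' → ∀ k l, (phiForm δ k / h28 a k < phiForm δ l / h28 a l ↔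
      phiForm δ' k / h28 a k < phiForm δ' l / h28 a l) := fun δ δ' h k l => by
    have := congrFun (congrFun h k) l
    rwa [hot, hot, decide_eq_decide] at this
  obtain ⟨T, hT⟩ : ∃ T : Finset (Fin 28 → Fin 28 → Bool), ∀ o, o ∈ T ↔
      ∃ δ : Fin 8 → ℝ, (∀ k l : Fin 28, k ≠ l → phiForm δ k / h28 a k ≠ phiForm δ l / h28 a l) ∧ ot δ = o :=
    ⟨(Set.toFinite {o | ∃ δ : Fin 8 → ℝ, (∀ k l : Fin 28, k ≠ l → phiForm δ k / h28 a k ≠ phiForm δ l / h28 a l) ∧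
      ot δ = o}).toFinset, fun o => by rw [Set.Finite.mem_toFinset]; rfl⟩
  obtain ⟨rep, hrep⟩ : ∃ rep : (Fin 28 → Fin 28 → Bool) → Fin 8 → ℝ, ∀ o, rep o =
      if h : ∃ δ : Fin 8 → ℝ, (∀ k l : Fin 28, k ≠ l → phiForm δ k / h28 a k ≠ phiForm δ l / h28 a l) ∧ ot δ = o
      then Classical.choose h else 0 := ⟨_, fun _ => rfl⟩
  have hrepT : ∀ o ∈ T, (∀ k l : Fin 28, k ≠ l → phiForm (rep o) k / h28 a k ≠ phiForm (rep o) l / h28 a l) ∧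
      ot (rep o) = o := by
    intro o ho
    rw [hT] at ho
    rw [hrep, dif_pos ho]
    exact Classical.choose_spec ho
  -- the sorting permutation of a generic reference determines its order type
  obtain ⟨perm, hperm⟩ : ∃ perm : (Fin 8 → ℝ) → Equiv.Perm (Fin 28), ∀ δ, perm δ =
      if h : ∀ k l : Fin 28, k ≠ l → phiForm δ k / h28 a k ≠ phiForm δ l / h28 a l
      then Classical.choose (exists_perm_of_generic h) else 1 := ⟨_, fun _ => rfl⟩
  have hperm' : ∀ δ, (∀ k l : Fin 28, k ≠ l → phiForm δ k / h28 a k ≠ phiForm δ l / h28 a l) →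
      ∀ k l, perm δ k < perm δ l ↔ phiForm δ k / h28 a k < phiForm δ l / h28 a l := by
    intro δ h
    rw [hperm, dif_pos h]
    exact Classical.choose_spec (exists_perm_of_generic h)
  have hinj : Set.InjOn (fun o => perm (rep o)) T := by
    intro o ho o' ho' he
    obtain ⟨hg, hoe⟩ := hrepT o ho
    obtain ⟨hg', hoe'⟩ := hrepT o' ho'
    rw [← hoe, ← hoe']
    funext k l
    rw [hot, hot]
    have h1 := hperm' _ hg k l
    have h2 := hperm' _ hg' k l
    simp only at he
    rw [he] at h1
    rw [Bool.decide_congr (h1.symm.trans h2)]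
  refine ⟨T.image rep, ?_, ?_, ?_⟩
  · refine Finset.card_image_le.trans ?_
    have h := Finset.card_le_card_of_injOn (fun o => perm (rep o)) (fun o _ => Finset.mem_univ _) hinj
    rwa [Finset.card_univ, Fintype.card_perm, Fintype.card_fin] at h
  · intro δ₁ hδ₁
    obtain ⟨o, ho, rfl⟩ := Finset.mem_image.mp hδ₁
    exact (hrepT o ho).1
  · intro δ₀ hgen
    have ho : ot δ₀ ∈ T := (hT _).mpr ⟨δ₀, hgen, rfl⟩
    refine ⟨rep (ot δ₀), Finset.mem_image_of_mem rep ho, hot' δ₀ (rep (ot δ₀)) (hrepT _ ho).2.symm⟩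

/-- **A CUSP TOP, EXACTLY — THE ORDER-TYPE FORM: FINITELY MANY FARKAS CERTIFICATES** (any period pattern function `F`,
any extension). All 28 forms of `a` positive, `T > 0` a period; `S` any set of generic references meeting every realised
order type (`exists_orderType_representatives`: a finite one with `#S ≤ 28!` exists). Then `cuspSlope a T δ ≤ 0` for
EVERY `δ` IFF each reference of `S` carries a Farkas certificate — P2 g34's criterion as a literally finite
conjunction of rational identities. No certificate instance is asserted. -/
theorem forall_cuspSlope_nonpos_iff_finset_farkas {a : Dir} (hpos : ∀ k, 0 < h28 a k) {T : ℝ} (hT : 0 < T)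
    (hper : ∀ k : Fin 28, ∃ z : ℤ, T * h28 a k = z)
    {M : ℕ → Finset (Fin 28)} {f : ℕ → Finset (Fin 28) → ℝ}
    (hf : ∀ m, m + 1 < (bkpts a T).card → ∀ Δ : Fin 8 → ℝ, (∀ k, |phiForm Δ k| < 1) →
      (∀ k, |phiForm Δ k| < wallDist a T) →
        (torusN (bkpt a T m • sParam a + Δ) : ℝ) = f m ((M m).filter fun k => 0 ≤ phiForm Δ k))
    {F : Finset (Fin 28) → ℝ} (hF : ∀ A, F A = ∑ m ∈ Finset.range ((bkpts a T).card - 1), f m (A ∩ M m))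
    {S : Finset (Fin 8 → ℝ)} (hSgen : ∀ δ₁ ∈ S, ∀ k l : Fin 28, k ≠ l → phiForm δ₁ k / h28 a k ≠ phiForm δ₁ l / h28 a l)
    (hS : ∀ δ₀ : Fin 8 → ℝ, (∀ k l : Fin 28, k ≠ l → phiForm δ₀ k / h28 a k ≠ phiForm δ₀ l / h28 a l) →
      ∃ δ₁ ∈ S, ∀ k l, phiForm δ₀ k / h28 a k < phiForm δ₀ l / h28 a l ↔
        phiForm δ₁ k / h28 a k < phiForm δ₁ l / h28 a l) :
    (∀ δ, cuspSlope a T δ ≤ 0) ↔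
      ∀ δ₁ ∈ S, ∃ μ : Fin 28 → Fin 28 → ℝ, (∀ k l, 0 ≤ μ k l) ∧ ∀ δ : Fin 8 → ℝ,
        ∑ k, (F (Finset.univ.filter fun l => phiForm δ₁ k / h28 a k ≤ phiForm δ₁ l / h28 a l) -
            F (Finset.univ.filter fun l => phiForm δ₁ k / h28 a k < phiForm δ₁ l / h28 a l)) *
          (phiForm δ k / h28 a k) +
        ∑ k, ∑ l, (if phiForm δ₁ k / h28 a k < phiForm δ₁ l / h28 a l then
          μ k l * (phiForm δ l / h28 a l - phiForm δ k / h28 a k) else 0) = 0 := by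
  rw [forall_cuspSlope_nonpos_iff_forall_farkas_certificate hpos hT hper hf hF]
  refine ⟨fun h δ₁ hδ₁ => h δ₁ (hSgen δ₁ hδ₁), fun h δ₀ hgen => ?_⟩
  obtain ⟨δ₁, hδ₁, hsame⟩ := hS δ₀ hgen
  exact (farkas_certificate_iff_of_same_order F hsame).mpr (h δ₁ hδ₁)

/-! ### Ray classes: the sign of `σ` on a ray class is read at two representatives -/

/-- **SAME TIE TYPE, SAME RAY CLASS**: if `x` is a ray (rigid tie pattern) and `x'` has two distinct rates and the ties of
`x`, then `x' = u•x + t•s(a)` with `u ≠ 0`, and accordingly `σ(x') = u·σ(x)` (`u > 0`) or `σ(x') = (−u)·σ(−x)` (`u < 0`)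
— all 28 forms positive, `T > 0` a period (gauge invariance and degree-1 homogeneity of `σ`). -/
theorem cuspSlope_ray_of_same_ties {a : Dir} (hpos : ∀ k, 0 < h28 a k) {T : ℝ} (hT : 0 < T)
    (hper : ∀ k : Fin 28, ∃ z : ℤ, T * h28 a k = z) {x x' : Fin 8 → ℝ}
    (hx : ∀ d : Fin 8 → ℝ, (∀ k l, phiForm x k / h28 a k = phiForm x l / h28 a l →
        phiForm d k / h28 a k = phiForm d l / h28 a l) → ∃ u t : ℝ, d = u • x + t • sParam a)
    (hx' : ∃ k l, phiForm x' k / h28 a k ≠ phiForm x' l / h28 a l)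
    (hties : ∀ k l, phiForm x k / h28 a k = phiForm x l / h28 a l → phiForm x' k / h28 a k = phiForm x' l / h28 a l) :
    ∃ u t : ℝ, u ≠ 0 ∧ x' = u • x + t • sParam a ∧
      (0 < u → cuspSlope a T x' = u * cuspSlope a T x) ∧
      (u < 0 → cuspSlope a T x' = (-u) * cuspSlope a T (-x)) := by
  obtain ⟨u, t, hu, rfl⟩ := ray_eq_smul_add_smul_of_ties hpos hx hx' hties
  refine ⟨u, t, hu, rfl, fun hup => cuspSlope_smul_add_smul_sParam hpos hT hper x hup t, fun hun => ?_⟩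
  have e : u • x + t • sParam a = (-u) • (-x) + t • sParam a := by rw [smul_neg, neg_smul, neg_neg]
  rw [e]
  exact cuspSlope_smul_add_smul_sParam hpos hT hper (-x) (by linarith) t

/-- **FINITELY MANY RAY CLASSES — A FINITE SET OF RAYS MEETS THEM ALL UP TO A POSITIVE GAUGE.** All 28 forms of `a`
positive. There is a finite set `S` of rays of the rate arrangement such that every ray `x` is `u•y + t•s(a)` for some
`y ∈ S` with `u > 0` (one ray and its negative per realised tie type). No count is claimed. -/
theorem exists_ray_representatives {a : Dir} (hpos : ∀ k, 0 < h28 a k) :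
    ∃ S : Finset (Fin 8 → ℝ),
      (∀ y ∈ S, (∃ k l, phiForm y k / h28 a k ≠ phiForm y l / h28 a l) ∧
        ∀ d : Fin 8 → ℝ, (∀ k l, phiForm y k / h28 a k = phiForm y l / h28 a l →
          phiForm d k / h28 a k = phiForm d l / h28 a l) → ∃ u t : ℝ, d = u • y + t • sParam a) ∧
      ∀ x : Fin 8 → ℝ, ((∃ k l, phiForm x k / h28 a k ≠ phiForm x l / h28 a l) ∧
          ∀ d : Fin 8 → ℝ, (∀ k l, phiForm x k / h28 a k = phiForm x l / h28 a l →
            phiForm d k / h28 a k = phiForm d l / h28 a l) → ∃ u t : ℝ, d = u • x + t • sParam a) →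
        ∃ y ∈ S, ∃ u t : ℝ, 0 < u ∧ x = u • y + t • sParam a := by
  classical
  -- tie type of a displacement, realised ray tie types, one representative ray each (and its negative)
  obtain ⟨tt, htt⟩ : ∃ tt : (Fin 8 → ℝ) → Fin 28 → Fin 28 → Bool, ∀ x k l,
      tt x k l = decide (phiForm x k / h28 a k = phiForm x l / h28 a l) := ⟨_, fun _ _ _ => rfl⟩
  have htt' : ∀ x x', tt x = tt x' → ∀ k l, phiForm x k / h28 a k = phiForm x l / h28 a l →
      phiForm x' k / h28 a k = phiForm x' l / h28 a l := fun x x' h k l hkl => by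
    have := congrFun (congrFun h k) l
    rw [htt, htt] at this
    exact of_decide_eq_true (this ▸ decide_eq_true hkl)
  obtain ⟨R, hR⟩ : ∃ R : (Fin 8 → ℝ) → Prop, ∀ x, R x = ((∃ k l, phiForm x k / h28 a k ≠ phiForm x l / h28 a l) ∧
      ∀ d : Fin 8 → ℝ, (∀ k l, phiForm x k / h28 a k = phiForm x l / h28 a l →
        phiForm d k / h28 a k = phiForm d l / h28 a l) → ∃ u t : ℝ, d = u • x + t • sParam a) :=
    ⟨_, fun _ => rfl⟩
  obtain ⟨Tt, hTt⟩ : ∃ Tt : Finset (Fin 28 → Fin 28 → Bool), ∀ o, o ∈ Tt ↔ ∃ x : Fin 8 → ℝ, R x ∧ tt x = o :=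
    ⟨(Set.toFinite {o | ∃ x : Fin 8 → ℝ, R x ∧ tt x = o}).toFinset, fun o => by rw [Set.Finite.mem_toFinset]; rfl⟩
  obtain ⟨rep, hrep⟩ : ∃ rep : (Fin 28 → Fin 28 → Bool) → Fin 8 → ℝ, ∀ o, rep o =
      if h : ∃ x : Fin 8 → ℝ, R x ∧ tt x = o then Classical.choose h else 0 := ⟨_, fun _ => rfl⟩
  have hrepT : ∀ o ∈ Tt, R (rep o) ∧ tt (rep o) = o := by
    intro o ho
    rw [hTt] at ho
    rw [hrep, dif_pos ho]
    exact Classical.choose_spec ho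
  refine ⟨Tt.image rep ∪ Tt.image (fun o => -rep o), fun y hy => ?_, fun x hx => ?_⟩
  · rcases Finset.mem_union.mp hy with hy | hy
    · obtain ⟨o, ho, rfl⟩ := Finset.mem_image.mp hy
      have h := (hrepT o ho).1
      rwa [hR] at h
    · obtain ⟨o, ho, rfl⟩ := Finset.mem_image.mp hy
      have h := (hrepT o ho).1
      rw [hR] at h
      have h' := ray_smul_add_smul_sParam hpos h (u := -1) (by norm_num) 0
      simp only [neg_smul, one_smul, zero_smul, add_zero] at h'
      exact h'
  · have hRx : R x := by rw [hR]; exact hx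
    have ho : tt x ∈ Tt := (hTt _).mpr ⟨x, hRx, rfl⟩
    obtain ⟨hRr, hto⟩ := hrepT _ ho
    rw [hR] at hRr
    obtain ⟨u, t, hu, hxe⟩ := ray_eq_smul_add_smul_of_ties hpos hRr.2 hx.1 (htt' _ _ hto)
    rcases lt_or_gt_of_ne hu with hun | hup
    · refine ⟨-rep (tt x), Finset.mem_union_right _ (Finset.mem_image_of_mem _ ho), -u, t, by linarith, ?_⟩
      rw [smul_neg, neg_smul, neg_neg]
      exact hxe
    · exact ⟨rep (tt x), Finset.mem_union_left _ (Finset.mem_image_of_mem _ ho), u, t, hup, hxe⟩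

/-- **A CUSP TOP, EXACTLY — FINITELY MANY RAY SIGNS** (any period pattern function `F`, any extension). All 28 forms of `a`
positive, `T > 0` a period; `S` any set of displacements meeting every ray class up to a positive gauge
(`exists_ray_representatives`: a finite one exists). Then `cuspSlope a T δ ≤ 0` for EVERY `δ` IFF `cuspSlope a T y ≤ 0`
for the finitely many `y ∈ S`. No sign at a named direction is asserted. -/
theorem forall_cuspSlope_nonpos_iff_finset_rays {a : Dir} (hpos : ∀ k, 0 < h28 a k) {T : ℝ} (hT : 0 < T)
    (hper : ∀ k : Fin 28, ∃ z : ℤ, T * h28 a k = z)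
    {M : ℕ → Finset (Fin 28)} {f : ℕ → Finset (Fin 28) → ℝ}
    (hf : ∀ m, m + 1 < (bkpts a T).card → ∀ Δ : Fin 8 → ℝ, (∀ k, |phiForm Δ k| < 1) →
      (∀ k, |phiForm Δ k| < wallDist a T) →
        (torusN (bkpt a T m • sParam a + Δ) : ℝ) = f m ((M m).filter fun k => 0 ≤ phiForm Δ k))
    {F : Finset (Fin 28) → ℝ} (hF : ∀ A, F A = ∑ m ∈ Finset.range ((bkpts a T).card - 1), f m (A ∩ M m))
    {S : Finset (Fin 8 → ℝ)}
    (hS : ∀ x : Fin 8 → ℝ, ((∃ k l, phiForm x k / h28 a k ≠ phiForm x l / h28 a l) ∧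
        ∀ d : Fin 8 → ℝ, (∀ k l, phiForm x k / h28 a k = phiForm x l / h28 a l →
          phiForm d k / h28 a k = phiForm d l / h28 a l) → ∃ u t : ℝ, d = u • x + t • sParam a) →
      ∃ y ∈ S, ∃ u t : ℝ, 0 < u ∧ x = u • y + t • sParam a) :
    (∀ δ, cuspSlope a T δ ≤ 0) ↔ ∀ y ∈ S, cuspSlope a T y ≤ 0 := by
  refine ⟨fun h y _ => h y, fun h => ?_⟩
  rw [forall_cuspSlope_nonpos_iff_forall_ray hpos hT hper hf hF]
  intro x _ hx
  obtain ⟨y, hy, u, t, hu, rfl⟩ := hS x hx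
  rw [cuspSlope_smul_add_smul_sParam hpos hT hper y hu t]
  exact mul_nonpos_of_nonneg_of_nonpos hu.le (h y hy)

/-! ### Canonical forms -/

/-- **THE ORDER-TYPE FORM, CANONICAL** (`F = Σ_m patternN a b_m`; hpos / hT / hper / hF and the covering set `S` only):
`σ ≤ 0` in every direction ⇔ the finitely many references of `S` carry Farkas certificates. -/
theorem forall_cuspSlope_nonpos_iff_finset_farkas_canonical {a : Dir} (hpos : ∀ k, 0 < h28 a k) {T : ℝ}
    (hT : 0 < T) (hper : ∀ k : Fin 28, ∃ z : ℤ, T * h28 a k = z) {F : Finset (Fin 28) → ℝ}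
    (hF : ∀ A, F A = ∑ m ∈ Finset.range ((bkpts a T).card - 1), ((patternN a (bkpt a T m) A : ℤ) : ℝ))
    {S : Finset (Fin 8 → ℝ)} (hSgen : ∀ δ₁ ∈ S, ∀ k l : Fin 28, k ≠ l → phiForm δ₁ k / h28 a k ≠ phiForm δ₁ l / h28 a l)
    (hS : ∀ δ₀ : Fin 8 → ℝ, (∀ k l : Fin 28, k ≠ l → phiForm δ₀ k / h28 a k ≠ phiForm δ₀ l / h28 a l) →
      ∃ δ₁ ∈ S, ∀ k l, phiForm δ₀ k / h28 a k < phiForm δ₀ l / h28 a l ↔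
        phiForm δ₁ k / h28 a k < phiForm δ₁ l / h28 a l) :
    (∀ δ, cuspSlope a T δ ≤ 0) ↔
      ∀ δ₁ ∈ S, ∃ μ : Fin 28 → Fin 28 → ℝ, (∀ k l, 0 ≤ μ k l) ∧ ∀ δ : Fin 8 → ℝ,
        ∑ k, (F (Finset.univ.filter fun l => phiForm δ₁ k / h28 a k ≤ phiForm δ₁ l / h28 a l) -
            F (Finset.univ.filter fun l => phiForm δ₁ k / h28 a k < phiForm δ₁ l / h28 a l)) *
          (phiForm δ k / h28 a k) +
        ∑ k, ∑ l, (if phiForm δ₁ k / h28 a k < phiForm δ₁ l / h28 a l then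
          μ k l * (phiForm δ l / h28 a l - phiForm δ k / h28 a k) else 0) = 0 := by
  classical
  exact forall_cuspSlope_nonpos_iff_finset_farkas hpos hT hper
    (M := fun m => Finset.univ.filter fun k => ∃ z : ℤ, bkpt a T m * h28 a k = z)
    (f := fun m A => ((patternN a (bkpt a T m) A : ℤ) : ℝ)) (canonical_junction_agreement a T)
    (canonical_period_eq_sum_inter hF) hSgen hS

/-- **FINITELY MANY RAY SIGNS, CANONICAL** (`F = Σ_m patternN a b_m`; hpos / hT / hper / hF and the covering set `S`
only): `σ ≤ 0` in every direction ⇔ `σ ≤ 0` at the finitely many rays of `S`. -/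
theorem forall_cuspSlope_nonpos_iff_finset_rays_canonical {a : Dir} (hpos : ∀ k, 0 < h28 a k) {T : ℝ} (hT : 0 < T)
    (hper : ∀ k : Fin 28, ∃ z : ℤ, T * h28 a k = z) {F : Finset (Fin 28) → ℝ}
    (hF : ∀ A, F A = ∑ m ∈ Finset.range ((bkpts a T).card - 1), ((patternN a (bkpt a T m) A : ℤ) : ℝ))
    {S : Finset (Fin 8 → ℝ)}
    (hS : ∀ x : Fin 8 → ℝ, ((∃ k l, phiForm x k / h28 a k ≠ phiForm x l / h28 a l) ∧
        ∀ d : Fin 8 → ℝ, (∀ k l, phiForm x k / h28 a k = phiForm x l / h28 a l →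
          phiForm d k / h28 a k = phiForm d l / h28 a l) → ∃ u t : ℝ, d = u • x + t • sParam a) →
      ∃ y ∈ S, ∃ u t : ℝ, 0 < u ∧ x = u • y + t • sParam a) :
    (∀ δ, cuspSlope a T δ ≤ 0) ↔ ∀ y ∈ S, cuspSlope a T y ≤ 0 := by
  classical
  exact forall_cuspSlope_nonpos_iff_finset_rays hpos hT hper
    (M := fun m => Finset.univ.filter fun k => ∃ z : ℤ, bkpt a T m * h28 a k = z)
    (f := fun m A => ((patternN a (bkpt a T m) A : ℤ) : ℝ)) (canonical_junction_agreement a T)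
    (canonical_period_eq_sum_inter hF) hS

end Summit.KontsevichZagierPeriods.Zeta5Search.Barrier.ConeGamma

end
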